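import Literature.Combinatorics.SimpleGraph.MengerGlue
import HarnessLib

/-!
# Menger's theorem (set form) for finite graphs

Topic `Literature/Combinatorics/SimpleGraph`; conclusion of `Menger.lean` / `MengerGlue.lean`.

**Theorem** (Menger 1927, set form; Diestel Thm. 3.3.1; Chartrand–Jordon–Vatter–Zhang Thm. 4.17).
Let `G` be a finite simple graph and `A, B ⊆ V(G)`. If every `A`–`B` separating set has at least
`k` vertices, then `G` contains `k` pairwise vertex-disjoint `A`–`B` paths
(`exists_abPathSystem_of_forall_isVxSeparator`; with the easy converse
`ABPathSystem.card_le_card_of_isVxSeparator` this is "max = min").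

**Proof** (Göring 2000, as presented by Chartrand et al.): induction on the number of edges. If
`G` has no edge, `A ∩ B` separates, so `k ≤ |A ∩ B|`, and `k` vertices of `A ∩ B` are `k` trivial
paths. Otherwise pick an edge `e = x₀y₀` and a minimum `A`–`B` separator `X` of `G - e`, say of
size `m`. If `k ≤ m` the induction hypothesis for `G - e` gives the paths. Else `X ∪ {x₀}` and
`X ∪ {y₀}` separate `A` from `B` in `G` (`IsVxSeparator.insert_of_deleteEdges`), so `|X| = k - 1`
and `x₀, y₀ ∉ X`; `X` does not separate in `G`, so some `A`–`B` path `W` of `G` avoids `X` and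
must use `e`, say from `a` to `b` (`{a, b} = {x₀, y₀}`), splitting as `W₁ e W₂`. Then every
`A`–`(X ∪ {a})` separator of `G - e` and every `(X ∪ {b})`–`B` separator of `G - e` separates `A`
from `B` in `G` (`isVxSeparator_of_insert_fst`, `isVxSeparator_of_insert_snd`, using `W₂`, `W₁`),
hence has `≥ k` vertices; the induction hypothesis gives `k` disjoint `A`–`(X ∪ {a})` paths and `k`
disjoint `(X ∪ {b})`–`B` paths of `G - e`, which `GluingData.glue` assembles into `k` disjoint
`A`–`B` paths of `G`.

## References

* K. Menger, Zur allgemeinen Kurventheorie, *Fund. Math.* 10 (1927) 96–115.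
* F. Göring, Short proof of Menger's theorem, *Discrete Math.* 219 (2000) 295–296 [Goring2000].
* R. Diestel, *Graph Theory*, 5th ed., GTM 173 (2017), Thm. 3.3.1 [Diestel2017].
* G. Chartrand, H. Jordon, V. Vatter, P. Zhang, *Graphs & Digraphs*, 7th ed. (2024), Thm. 4.17.
-/

namespace Literature.Combinatorics.SimpleGraph

open _root_.SimpleGraph

universe u

variable {V : Type u} [DecidableEq V] {G : _root_.SimpleGraph V} {A B : Set V}

/-! ### The two separator claims of the induction step -/

/-- **Claim A.** Let `X` separate `A` from `B` in `G - ab` and let `W₂` be a walk of `G - ab` from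
`b` to `B` avoiding `X`. Then every `A`–`(X ∪ {a})` separator `Z` of `G - ab` separates `A` from
`B` in `G`: an `A`–`B` path of `G` either avoids `ab` (and meets `X`), or runs `… a b …` (its part
up to `a` is an `A`–`(X ∪ {a})` walk of `G - ab`), or runs `… b a …` — and then its part up to `b`
followed by `W₂` is an `A`–`B` walk of `G - ab`, which meets `X` before `b`.
[cite: Goring2000, proof of the Theorem (A–B set form)] -/
theorem isVxSeparator_of_insert_fst {a b : V} {X Z : Set V}
    (hX : IsVxSeparator (G.deleteEdges {s(a, b)}) A B X) {v : V} (hv : v ∈ B)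
    (W₂ : (G.deleteEdges {s(a, b)}).Walk b v) (hW₂ : ∀ z ∈ W₂.support, z ∉ X)
    (hZ : IsVxSeparator (G.deleteEdges {s(a, b)}) A (insert a X) Z) :
    IsVxSeparator G A B Z := by
  intro u₁ v₁ hu₁ hv₁ p
  suffices h : ∃ z ∈ p.bypass.support, z ∈ Z by
    obtain ⟨z, hz, hzZ⟩ := h
    exact ⟨z, p.support_bypass_subset_support hz, hzZ⟩
  have hpath := p.bypass_isPath
  by_cases hqe : s(a, b) ∈ p.bypass.edges
  · obtain ⟨c, d, q₁, hcd, q₂, hs, hqeq⟩ := exists_append_cons_of_mem_edges p.bypass hqe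
    have hqt := hpath.isTrail
    rw [hqeq] at hqt
    obtain ⟨hq₁e, -⟩ := not_mem_edges_of_isTrail_append_cons hqt
    rw [hs] at hq₁e
    rw [hqeq]
    obtain ⟨q₁', hq₁', -⟩ := exists_walk_deleteEdges_of_not_mem_edges (s(a, b)) q₁ hq₁e
    rcases Sym2.eq_iff.1 hs with ⟨rfl, rfl⟩ | ⟨rfl, rfl⟩
    · -- the path runs `… a b …`
      obtain ⟨z, hz, hzZ⟩ := hZ hu₁ (Set.mem_insert _ _) q₁'
      exact ⟨z, by rw [Walk.mem_support_append_iff, ← hq₁']; exact Or.inl hz, hzZ⟩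
    · -- the path runs `… b a …`
      obtain ⟨z₀, hz₀, hz₀X⟩ := hX hu₁ hv (q₁'.append W₂)
      rw [Walk.mem_support_append_iff] at hz₀
      have hz₀q : z₀ ∈ q₁'.support := by
        rcases hz₀ with h | h
        · exact h
        · exact absurd hz₀X (hW₂ z₀ h)
      obtain ⟨z, hz, hzZ⟩ := hZ hu₁ (Set.mem_insert_of_mem _ hz₀X) (q₁'.takeUntil z₀ hz₀q)
      refine ⟨z, ?_, hzZ⟩
      rw [Walk.mem_support_append_iff, ← hq₁']
      exact Or.inl (q₁'.support_takeUntil_subset_support hz₀q hz)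
  · obtain ⟨q', hq', -⟩ := exists_walk_deleteEdges_of_not_mem_edges (s(a, b)) p.bypass hqe
    obtain ⟨z₀, hz₀, hz₀X⟩ := hX hu₁ hv₁ q'
    obtain ⟨z, hz, hzZ⟩ := hZ hu₁ (Set.mem_insert_of_mem _ hz₀X) (q'.takeUntil z₀ hz₀)
    exact ⟨z, hq' ▸ q'.support_takeUntil_subset_support hz₀ hz, hzZ⟩

/-- **Claim B** (symmetric to Claim A). Let `X` separate `A` from `B` in `G - ab` and let `W₁` be
a walk of `G - ab` from `A` to `a` avoiding `X`. Then every `(X ∪ {b})`–`B` separator `Z` of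
`G - ab` separates `A` from `B` in `G`. [cite: Goring2000, proof of the Theorem (A–B set form)] -/
theorem isVxSeparator_of_insert_snd {a b : V} {X Z : Set V}
    (hX : IsVxSeparator (G.deleteEdges {s(a, b)}) A B X) {u : V} (hu : u ∈ A)
    (W₁ : (G.deleteEdges {s(a, b)}).Walk u a) (hW₁ : ∀ z ∈ W₁.support, z ∉ X)
    (hZ : IsVxSeparator (G.deleteEdges {s(a, b)}) (insert b X) B Z) :
    IsVxSeparator G A B Z := by
  intro u₁ v₁ hu₁ hv₁ p
  suffices h : ∃ z ∈ p.bypass.support, z ∈ Z by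
    obtain ⟨z, hz, hzZ⟩ := h
    exact ⟨z, p.support_bypass_subset_support hz, hzZ⟩
  have hpath := p.bypass_isPath
  by_cases hqe : s(a, b) ∈ p.bypass.edges
  · obtain ⟨c, d, q₁, hcd, q₂, hs, hqeq⟩ := exists_append_cons_of_mem_edges p.bypass hqe
    have hqt := hpath.isTrail
    rw [hqeq] at hqt
    obtain ⟨-, hq₂e⟩ := not_mem_edges_of_isTrail_append_cons hqt
    rw [hs] at hq₂e
    rw [hqeq]
    obtain ⟨q₂', hq₂', -⟩ := exists_walk_deleteEdges_of_not_mem_edges (s(a, b)) q₂ hq₂e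
    rcases Sym2.eq_iff.1 hs with ⟨rfl, rfl⟩ | ⟨rfl, rfl⟩
    · -- the path runs `… a b …`: its part from `b` is an `(X ∪ {b})`–`B` walk of `G - ab`
      obtain ⟨z, hz, hzZ⟩ := hZ (Set.mem_insert _ _) hv₁ q₂'
      refine ⟨z, ?_, hzZ⟩
      rw [Walk.mem_support_append_iff, Walk.support_cons, List.mem_cons, ← hq₂']
      exact Or.inr (Or.inr hz)
    · -- the path runs `… b a …`: `W₁` followed by its part from `a` meets `X` after `a`
      obtain ⟨z₀, hz₀, hz₀X⟩ := hX hu hv₁ (W₁.append q₂')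
      rw [Walk.mem_support_append_iff] at hz₀
      have hz₀q : z₀ ∈ q₂'.support := by
        rcases hz₀ with h | h
        · exact absurd hz₀X (hW₁ z₀ h)
        · exact h
      obtain ⟨z, hz, hzZ⟩ := hZ (Set.mem_insert_of_mem _ hz₀X) hv₁ (q₂'.dropUntil z₀ hz₀q)
      refine ⟨z, ?_, hzZ⟩
      rw [Walk.mem_support_append_iff, Walk.support_cons, List.mem_cons, ← hq₂']
      exact Or.inr (Or.inr (q₂'.support_dropUntil_subset_support hz₀q hz))
  · obtain ⟨q', hq', -⟩ := exists_walk_deleteEdges_of_not_mem_edges (s(a, b)) p.bypass hqe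
    obtain ⟨z₀, hz₀, hz₀X⟩ := hX hu₁ hv₁ q'
    obtain ⟨z, hz, hzZ⟩ := hZ (Set.mem_insert_of_mem _ hz₀X) hv₁ (q'.dropUntil z₀ hz₀)
    exact ⟨z, hq' ▸ q'.support_dropUntil_subset_support hz₀ hz, hzZ⟩

/-! ### Menger's theorem -/

/-- The induction on the number of edges (see the module docstring).
[cite: Goring2000, proof of the Theorem (A–B set form)] -/
theorem exists_abPathSystem_aux [Fintype V] (n : ℕ) :
    ∀ (G : _root_.SimpleGraph V), G.edgeSet.ncard = n → ∀ (A B : Set V) (k : ℕ),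
      (∀ S : Finset V, IsVxSeparator G A B ↑S → k ≤ S.card) →
      ∃ (ι : Type u) (_ : Fintype ι), Fintype.card ι = k ∧ Nonempty (ABPathSystem G A B ι) := by
  induction n using Nat.strong_induction_on with
  | _ n ih =>
  intro G hG A B k hk
  classical
  by_cases hE : G.edgeSet = ∅
  · -- no edges: `A ∩ B` separates, and `k` of its vertices are `k` trivial paths
    have hbot : G = ⊥ := edgeSet_eq_empty.1 hE
    subst hbot
    have hsep : IsVxSeparator (⊥ : _root_.SimpleGraph V) A B ↑(Set.toFinite (A ∩ B)).toFinset := by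
      rw [Set.Finite.coe_toFinset]; exact IsVxSeparator.bot_inter A B
    obtain ⟨T, hT, hTcard⟩ := Finset.exists_subset_card_eq (hk _ hsep)
    refine ⟨(↑T : Set V), inferInstance, ?_, ⟨ABPathSystem.trivial T fun z hz => ?_⟩⟩
    · rw [← hTcard]; exact Fintype.card_of_subtype T fun _ => Finset.mem_coe.symm
    · have := hT hz
      rwa [Set.Finite.mem_toFinset] at this
  · -- an edge `e`; a minimum separator `X` of `G - e`
    obtain ⟨e, he⟩ := Set.nonempty_iff_ne_empty.2 hE
    have hn1 : 1 ≤ n := by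
      rw [← hG]; exact (Set.ncard_pos (Set.toFinite _)).2 ⟨e, he⟩
    have hcard' : (G.deleteEdges {e}).edgeSet.ncard = n - 1 := by
      rw [edgeSet_deleteEdges, Set.ncard_sdiff_singleton_of_mem he, hG]
    have ih' := ih (n - 1) (by omega) (G.deleteEdges {e}) hcard'
    have hex : ∃ m, ∃ S : Finset V, IsVxSeparator (G.deleteEdges {e}) A B ↑S ∧ S.card = m :=
      ⟨_, (Set.toFinite A).toFinset, by
        rw [Set.Finite.coe_toFinset]; exact isVxSeparator_left A B, rfl⟩
    obtain ⟨X, hXsep, hXcard⟩ := Nat.find_spec hex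
    have hmin : ∀ S : Finset V, IsVxSeparator (G.deleteEdges {e}) A B ↑S → Nat.find hex ≤ S.card :=
      fun S hS => Nat.find_min' hex ⟨S, hS, rfl⟩
    by_cases hkm : k ≤ Nat.find hex
    · -- enough disjoint paths already in `G - e`
      obtain ⟨ι, _, hι, ⟨P⟩⟩ := ih' A B k fun S hS => hkm.trans (hmin S hS)
      exact ⟨ι, inferInstance, hι, ⟨P.mapLe (G.deleteEdges_le _)⟩⟩
    · -- `|X| = k - 1`, the endpoints of `e` are not in `X`, and `X` does not separate in `G`
      push Not at hkm
      rw [← hXcard] at hkm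
      induction e using Sym2.ind with
      | _ x₀ y₀ =>
      have h1 : k ≤ (insert x₀ X).card :=
        hk _ (by rw [Finset.coe_insert]; exact hXsep.insert_of_deleteEdges)
      have h2 : k ≤ (insert y₀ X).card :=
        hk _ (by rw [Finset.coe_insert]; exact hXsep.insert_of_deleteEdges')
      have hx₀ : x₀ ∉ X := fun h => by rw [Finset.insert_eq_of_mem h] at h1; omega
      have hy₀ : y₀ ∉ X := fun h => by rw [Finset.insert_eq_of_mem h] at h2; omega
      have hXk : X.card + 1 = k := by rw [Finset.card_insert_of_notMem hx₀] at h1; omega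
      have hnot : ¬ IsVxSeparator G A B ↑X := fun h => by have := hk X h; omega
      unfold IsVxSeparator at hnot
      push Not at hnot
      obtain ⟨u, v, hu, hv, W, hW⟩ := hnot
      -- the `A`–`B` path `W.bypass` avoids `X`, hence uses `e`, say from `a` to `b`
      have hWe : s(x₀, y₀) ∈ W.bypass.edges := by
        by_contra hWe
        obtain ⟨W', hW', -⟩ := exists_walk_deleteEdges_of_not_mem_edges _ W.bypass hWe
        obtain ⟨z, hz, hzX⟩ := hXsep hu hv W'
        exact hW z (W.support_bypass_subset_support (hW' ▸ hz)) hzX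
      obtain ⟨a, b, W₁, hab, W₂, hs, hWeq⟩ := exists_append_cons_of_mem_edges W.bypass hWe
      have htrail := W.bypass_isPath.isTrail
      rw [hWeq] at htrail
      obtain ⟨hW₁e, hW₂e⟩ := not_mem_edges_of_isTrail_append_cons htrail
      have hsub : ∀ z ∈ (W₁.append (Walk.cons hab W₂)).support, z ∉ (↑X : Set V) :=
        fun z hz => hW z (W.support_bypass_subset_support (hWeq ▸ hz))
      have hsub₁ : ∀ z ∈ W₁.support, z ∉ (↑X : Set V) :=
        fun z hz => hsub z (by rw [Walk.mem_support_append_iff]; exact Or.inl hz)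
      have hsub₂ : ∀ z ∈ W₂.support, z ∉ (↑X : Set V) := fun z hz => hsub z (by
        rw [Walk.mem_support_append_iff, Walk.support_cons, List.mem_cons]; exact Or.inr (Or.inr hz))
      have haX : a ∉ X := hsub₁ a W₁.end_mem_support
      have hbX : b ∉ X := hsub₂ b W₂.start_mem_support
      -- from now on the deleted edge is written `s(a, b)`
      rw [← hs] at hXsep ih'
      obtain ⟨W₁', hW₁', -⟩ := exists_walk_deleteEdges_of_not_mem_edges (s(a, b)) W₁ hW₁e
      obtain ⟨W₂', hW₂', -⟩ := exists_walk_deleteEdges_of_not_mem_edges (s(a, b)) W₂ hW₂e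
      rw [← hW₁'] at hsub₁
      rw [← hW₂'] at hsub₂
      -- Claim A / Claim B and the induction hypothesis, twice
      have hkA : ∀ Z : Finset V,
          IsVxSeparator (G.deleteEdges {s(a, b)}) A ↑(insert a X) ↑Z → k ≤ Z.card := fun Z hZ =>
        hk Z (isVxSeparator_of_insert_fst hXsep hv W₂' hsub₂ (by rwa [Finset.coe_insert] at hZ))
      have hkB : ∀ Z : Finset V,
          IsVxSeparator (G.deleteEdges {s(a, b)}) ↑(insert b X) B ↑Z → k ≤ Z.card := fun Z hZ =>
        hk Z (isVxSeparator_of_insert_snd hXsep hu W₁' hsub₁ (by rwa [Finset.coe_insert] at hZ))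
      obtain ⟨ι₁, _, hι₁, ⟨P₀⟩⟩ := ih' A ↑(insert a X) k hkA
      obtain ⟨ι₂, _, hι₂, ⟨Q₀⟩⟩ := ih' ↑(insert b X) B k hkB
      have hcardA : Fintype.card ι₁ = (insert a X).card := by
        rw [hι₁, Finset.card_insert_of_notMem haX, hXk]
      have hcardB : Fintype.card ι₂ = (insert b X).card := by
        rw [hι₂, Finset.card_insert_of_notMem hbX, hXk]
      obtain ⟨P, hP⟩ := P₀.exists_reindex_lst (insert a X) (fun i => P₀.lst_mem i) hcardA
      obtain ⟨Q, hQ⟩ := Q₀.exists_reindex_fst (insert b X) (fun j => Q₀.fst_mem j) hcardB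
      -- glue
      let D : GluingData G A B :=
        { X := X, x := a, y := b, adj := hab, x_notMem := haX, y_notMem := hbX, sep := hXsep,
          P := P, lst_P := hP, Q := Q, fst_Q := hQ }
      refine ⟨Option (↑X : Set V), inferInstance, ?_, ⟨D.glue⟩⟩
      rw [Fintype.card_option, Fintype.card_of_subtype X fun _ => Finset.mem_coe.symm, hXk]

/-- **Menger's theorem, set form** (Menger 1927; Göring's proof): in a finite graph, if every
`A`–`B` separating set has at least `k` vertices, then there are `k` pairwise vertex-disjoint
`A`–`B` paths (indexed by some finite type of cardinality `k`; see
`exists_abPathSystem_fin_of_forall_isVxSeparator` for `Fin k`). Together with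
`ABPathSystem.card_le_card_of_isVxSeparator`: the maximum number of disjoint `A`–`B` paths equals
the minimum size of an `A`–`B` separator. [cite: Diestel2017, Thm. 3.3.1] -/
theorem exists_abPathSystem_of_forall_isVxSeparator [Fintype V] (G : _root_.SimpleGraph V)
    (A B : Set V) (k : ℕ) (hk : ∀ S : Finset V, IsVxSeparator G A B ↑S → k ≤ S.card) :
    ∃ (ι : Type u) (_ : Fintype ι), Fintype.card ι = k ∧ Nonempty (ABPathSystem G A B ι) :=
  exists_abPathSystem_aux _ G rfl A B k hk

/-- **Menger's theorem, set form, `Fin k`-indexed**: under the same hypothesis there is a system of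
`k` pairwise vertex-disjoint `A`–`B` paths indexed by `Fin k`. [cite: Diestel2017, Thm. 3.3.1] -/
theorem exists_abPathSystem_fin_of_forall_isVxSeparator [Fintype V] (G : _root_.SimpleGraph V)
    (A B : Set V) (k : ℕ) (hk : ∀ S : Finset V, IsVxSeparator G A B ↑S → k ≤ S.card) :
    Nonempty (ABPathSystem G A B (ULift.{u} (Fin k))) := by
  obtain ⟨ι, _, hι, ⟨P⟩⟩ := exists_abPathSystem_of_forall_isVxSeparator G A B k hk
  exact ⟨P.reindex (Equiv.ulift.trans ((Fintype.equivFinOfCardEq hι).symm))⟩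

/-- **Menger's theorem, "max = min" packaging**: the largest size of a system of disjoint `A`–`B`
paths indexed by `Fin k` equals the least size of an `A`–`B` separator, in the form: for every `k`,
(there are `k` disjoint `A`–`B` paths) iff (every separator has `≥ k` vertices).
[cite: Diestel2017, Thm. 3.3.1] -/
theorem nonempty_abPathSystem_iff [Fintype V] (G : _root_.SimpleGraph V) (A B : Set V) (k : ℕ) :
    Nonempty (ABPathSystem G A B (ULift.{u} (Fin k))) ↔
      ∀ S : Finset V, IsVxSeparator G A B ↑S → k ≤ S.card := by
  constructor
  · rintro ⟨P⟩ S hS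
    simpa using P.card_le_card_of_isVxSeparator hS
  · exact exists_abPathSystem_fin_of_forall_isVxSeparator G A B k

end Literature.Combinatorics.SimpleGraph
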